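import Summits.QuantumFields.BalabanUV.T4Continuum.Support.GaugeTermDecomposition
import Summits.QuantumFields.BalabanUV.Beta.AdjointCarrierWiringEnd

/-!
# T⁴ programme, spine node NE2 (U1a) — (3.10)'s CURVATURE PART `Δ′` TYPED AS AN OPERATOR ON THE TIER-B CARRIERS (residual r1 of the dictionary B0;
# repair R13, file 1: the object, its plaquette blocks, `Δ′ = 0` at the flat background, Hermitian for unitary `U`; NO estimate)

Cell `pub-balaban-gaps` (track G2, seat ne2 = spine estimate NE2; census `run/shared/lean/pub/pub-balaban-gaps/ne/NE2.md` §5 R13, plan `ne/NE2-R13-PLAN.md`).  After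
`Spine/NE2/DictionaryB0` (principal part of [B9] (3.26) = `covLapC + lift commOp − sand`, EXACT) the located residuals of B0 are (r1) the curvature part `Δ′` of the
Hessian (3.10), (r2) the averaging term, (r3) the instance.  [Balaban1985BackgroundPropagators] p.392, (3.10) (verbatim, re-read on the page image by
`Literature/…/B9Eq310DeltaPrime`): «⟨A, ΔA⟩ = ⟨A, D*DA⟩ + ⟨A, Δ′A⟩, ⟨A, Δ′A⟩ = Σ_{p⊂T_η} η^d tr((D¹_U A)(p))²η⁻²(Re U(∂p) − 1) + tr Σ_{b₁,b₂⊂∂(p)_z, b₁≺b₂}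
i[A′(b₁), A′(b₂)]η⁻² Im U(∂p). … the operator Δ′ will be a bounded, small operator, which will be treated as a small perturbation of D*D.»; p.392 «For U with values
in the unitary group U(N) it is a hermitian operator»; p.390 (3.2) «A′(z, w) = R(U₀(x, w))A(z, w), A′(w, x) = A(w, x), A′(x, y) = A(x, y), A′(y, z) = R(U₀(x, y))·A(y, z)»
along «∂(p)_z = ⟨z, w⟩ ∪ ⟨w, x⟩ ∪ ⟨x, y⟩ ∪ ⟨y, z⟩»; p.391 (3.4), (3.5) «A(x, x′) = −A(x′, x)», «Re U₀(∂p) = ½(U₀(∂p) + U₀(−∂p)), Im U₀(∂p) = (1/2i)(U₀(∂p) − U₀(−∂p))».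
`B9Eq310DeltaPrime` types this as a bilinear FORM (its (M2): «the operator Δ′ … NOT constructed here»); THIS FILE constructs the OPERATOR on ROOT B's carriers — component 1-forms `(Tor Nf × Fin d) × ι`, `ι` indexing a trace-orthonormal hermitian family `e : ι → M_n(ℂ)` (`Beta.AdjointCarrierWiringEnd.
CompFamily`), `R(U) = Ad U` in components (`Beta.AdjointCarrierWiring.adMat`):
 * §1 COMPONENT TENSORS `symF c e W` (`(k,l) ↦ (c/2)·Tr((e_k e_l + e_l e_k)·W)`, the matrix of `X ↦ tr(X²W)`), `brkF c e V` (`(k,l) ↦ c·Tr(i(e_k e_l − e_l e_k)·V)`, the matrix of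
   `(X,Y) ↦ tr(i[X,Y]V)`); `symF` symmetric, `brkF` antisymmetric, both `0` at `0`;
 * §2 PLAQUETTE DATA of a bond field `V μ x = U(x, x+e_μ) ∈ M_n(ℂ)`: `plaqHol` (`U(∂p)`, [Balaban1985Averaging] (9) order), `reHol`, `imHol` (p.391), the transported
   evaluation `tproj R b`, the four EDGE MAPS `edgeM … j` (components of `A′(b_j)` in the order `≺`, (3.2)/(3.5) — `B9Eq310DeltaPrime.edgeLin` in components), `curlRow = Σ_j edgeM j`;
 * §3 THE OPERATOR: `plaqBlock₁ = curlRowᵀ·symF(cη²(Re U(∂p) − 1))·curlRow`, `plaqBlock₂ = Σ_{j<j′} ½(edgeM jᵀ·brkF(cη² Im U(∂p))·edgeM j′ + transpose)`,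
   **`deltaPrime cη c e V = Σ_x Σ_{μ<ν} (plaqBlock₁ + plaqBlock₂)`** (Riesz matrix of the polarised (3.10) on component space; the uniform measure `η^d` dropped on both sides as
   for `DictionaryB0.hessB9`; `cη = η⁻¹`; component normalisation `Σ_k a_k² = c·Tr(X*X)`); `deltaPrime_transpose`; **`deltaPrime_flat`** (`Δ′ = 0` at `V ≡ 1`);
 * §4 **`deltaPrime_isHermitian`**: for a UNITARY bond field and a Hermitian family the entries are real (`ᴴ = ᵀ` through `reHol_isHermitian`, `imHol_isHermitian`,
   `real_symF/real_brkF/real_edgeM`), hence `Δ′` is Hermitian — p.392's sentence, for the typed object;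
 * §5 entry formulas `tproj_mulVec`, **`curlRow_mulVec`** = (3.4) in components (unit-lattice form, `= (D¹_μA_ν − D¹_νA_μ)(x)`).
NOT HERE (R13 files 2–3): `PerturbationLaws` for `deltaPrime`, and the equation with `B9Eq310DeltaPrime.curvForm` through a chart.

HONEST FRAMING (T4-DAG p. 1).  Definitions of OUR objects realising the printed formula (3.10) on the tree's carriers + definitional/algebraic lemmas; `V`, `e`, `c`, `cη` DATA;
the expansion (3.1)–(3.7) producing (3.10) is NOT typed (the operator is DEFINED by its printed second-order terms, as in `B9Eq310DeltaPrime`); no estimate («bounded, small»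
is NOT proved); nothing printed is a hypothesis or a conclusion; NE2 (U1a) NOT PROVED; spine PROVED 0/9 unchanged; NOT continuum YM / infinite volume / mass gap / Clay.
HONEST DEPENDENCY: continuum YM on T⁴ ⇐ BetaPertH ∧ nine spine estimates (0/9 proved); BetaPertH ⇐ (D1) ∧ (D4) ∧ CAP+tail; G-an2-4 gates asym, D1 and NE2/3/4.  No `sorry`.
-/

noncomputable section

open scoped BigOperators ComplexConjugate Matrix

namespace Summit.QuantumFields.BalabanUV.T4Continuum.NE2.DeltaPrimeOperator

open Literature.MathematicalPhysics.QuantumFieldTheory.Balaban1983to89.B5Prop11Plancherel (Tor unitVec)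
open Summit.QuantumFields.BalabanUV.Beta.AdjointCarrierWiring (adMat adMat_one)

variable {n : Type} [Fintype n] [DecidableEq n] {ι : Type} [Fintype ι] [DecidableEq ι]

/-! ## §1 Component tensors of a hermitian family -/
/-- **the matrix of `X ↦ tr(X²·W)` in components**: `symF c e W k l = (c/2)·Tr((e_k e_l + e_l e_k)·W)` (unnormalised trace `Tr`, family constant `c` of
`B9AdOrthogonal.form`). [cite: Balaban1985BackgroundPropagators, (3.10) p.392 (first term, shape)] [folklore] -/
def symF (c : ℝ) (e : ι → Matrix n n ℂ) (W : Matrix n n ℂ) : Matrix ι ι ℂ :=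
  Matrix.of fun k l => ((c : ℂ) / 2) * Matrix.trace ((e k * e l + e l * e k) * W)

/-- **the matrix of `(X, Y) ↦ tr(i[X, Y]·V)` in components**: `brkF c e V k l = c·Tr(i(e_k e_l − e_l e_k)·V)`.
[cite: Balaban1985BackgroundPropagators, (3.10) p.392 (second term, shape)] [folklore] -/
def brkF (c : ℝ) (e : ι → Matrix n n ℂ) (V : Matrix n n ℂ) : Matrix ι ι ℂ :=
  Matrix.of fun k l => (c : ℂ) * Matrix.trace ((Complex.I • (e k * e l - e l * e k)) * V)

omit [Fintype ι] [DecidableEq ι] in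
/-- `symF` vanishes at `W = 0`. [folklore] -/
@[simp] theorem symF_zero (c : ℝ) (e : ι → Matrix n n ℂ) : symF c e 0 = 0 := by
  ext k l; simp [symF]

omit [Fintype ι] [DecidableEq ι] in
/-- `brkF` vanishes at `V = 0`. [folklore] -/
@[simp] theorem brkF_zero (c : ℝ) (e : ι → Matrix n n ℂ) : brkF c e 0 = 0 := by
  ext k l; simp [brkF]

omit [DecidableEq n] [Fintype ι] [DecidableEq ι] in
/-- `symF` is symmetric. [folklore] -/
theorem symF_transpose (c : ℝ) (e : ι → Matrix n n ℂ) (W : Matrix n n ℂ) : (symF c e W)ᵀ = symF c e W := by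
  ext k l; simp only [symF, Matrix.transpose_apply, Matrix.of_apply]; rw [add_comm]

omit [DecidableEq n] [Fintype ι] [DecidableEq ι] in
/-- `brkF` is antisymmetric (`[X, Y] = −[Y, X]`). [folklore] -/
theorem brkF_transpose (c : ℝ) (e : ι → Matrix n n ℂ) (V : Matrix n n ℂ) : (brkF c e V)ᵀ = -brkF c e V := by
  ext k l
  simp only [brkF, Matrix.transpose_apply, Matrix.of_apply, Matrix.neg_apply]
  rw [← mul_neg, ← Matrix.trace_neg, ← Matrix.neg_mul, ← smul_neg, neg_sub]

/-! ## §2 Plaquette data of a bond field and the four edge maps -/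

section Plaquette

variable {d : ℕ} (Nf : Fin d → ℕ) [hNf : ∀ μ, NeZero (Nf μ)]

/-- **the plaquette holonomy** `U(∂p) = U(x,y)U(y,z)U(z,w)U(w,x)` of `p = p_{μν}(x) = ⟨x, x+e_μ, x+e_μ+e_ν, x+e_ν⟩`, i.e.
`V_μ(x)·V_ν(x+e_μ)·V_μ(x+e_ν)⁻¹·V_ν(x)⁻¹` (backward bonds inverted, (3.5)). [cite: Balaban1985BackgroundPropagators, (3.1) p.390 «U(∂p)» (shape)] [folklore] -/
def plaqHol (V : Fin d → Tor Nf → Matrix n n ℂ) (x : Tor Nf) (μ ν : Fin d) : Matrix n n ℂ :=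
  V μ x * V ν (x + unitVec Nf μ) * (V μ (x + unitVec Nf ν))⁻¹ * (V ν x)⁻¹

/-- «Re U(∂p) = ½(U(∂p) + U(−∂p))», `U(−∂p) = U(∂p)⁻¹`. [cite: Balaban1985BackgroundPropagators, p.391 (shape)] [folklore] -/
def reHol (V : Fin d → Tor Nf → Matrix n n ℂ) (x : Tor Nf) (μ ν : Fin d) : Matrix n n ℂ :=
  (1 / 2 : ℂ) • (plaqHol Nf V x μ ν + (plaqHol Nf V x μ ν)⁻¹)

/-- «Im U(∂p) = (1/2i)(U(∂p) − U(−∂p))». [cite: Balaban1985BackgroundPropagators, p.391 (shape)] [folklore] -/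
def imHol (V : Fin d → Tor Nf → Matrix n n ℂ) (x : Tor Nf) (μ ν : Fin d) : Matrix n n ℂ :=
  (-Complex.I / 2) • (plaqHol Nf V x μ ν - (plaqHol Nf V x μ ν)⁻¹)

omit hNf in
/-- flat background: `U(∂p) = 1`. [folklore] -/
@[simp] theorem plaqHol_one (x : Tor Nf) (μ ν : Fin d) : plaqHol Nf (fun (_ : Fin d) (_ : Tor Nf) => (1 : Matrix n n ℂ)) x μ ν = 1 := by
  simp [plaqHol]

omit hNf in
/-- flat background: `Re U(∂p) = 1`. [folklore] -/
@[simp] theorem reHol_one (x : Tor Nf) (μ ν : Fin d) : reHol Nf (fun (_ : Fin d) (_ : Tor Nf) => (1 : Matrix n n ℂ)) x μ ν = 1 := by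
  rw [reHol, plaqHol_one, inv_one, ← two_smul ℂ (1 : Matrix n n ℂ), smul_smul]
  norm_num

omit hNf in
/-- flat background: `Im U(∂p) = 0`. [folklore] -/
@[simp] theorem imHol_one (x : Tor Nf) (μ ν : Fin d) : imHol Nf (fun (_ : Fin d) (_ : Tor Nf) => (1 : Matrix n n ℂ)) x μ ν = 0 := by
  rw [imHol, plaqHol_one, inv_one, sub_self, smul_zero]

/-- TRANSPORTED EVALUATION of a component 1-form at the bond `b = (y, κ)` through a colour matrix `R`: the row block
`(tproj R b)_{k, ((y′,κ′),l)} = [(y′,κ′) = (y,κ)]·R_{kl}` (components of `R·A(b)`). [folklore] -/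
def tproj (R : Matrix ι ι ℂ) (b : Tor Nf × Fin d) : Matrix ι ((Tor Nf × Fin d) × ι) ℂ := fun k q => if q.1 = b then R k q.2 else 0

variable (cη : ℝ) (c : ℝ) (e : ι → Matrix n n ℂ)

/-- **THE FOUR TRANSPORTED EDGE VARIABLES `A′(b)`, `b ⊂ ∂(p)_z`, IN COMPONENTS** (order `≺`: `⟨z,w⟩, ⟨w,x⟩, ⟨x,y⟩, ⟨y,z⟩`; `p = p_{μν}(x)`, `y = x+e_μ`, `z = x+e_μ+e_ν`,
`w = x+e_ν`; (3.5) turns backward bonds into minus the forward components): `A′(z,w) = −R(U_ν(x))A_μ(x+e_ν)`, `A′(w,x) = −A_ν(x)`, `A′(x,y) = A_μ(x)`,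
`A′(y,z) = R(U_μ(x))A_ν(x+e_μ)`, with `R(u) = adMat c e u` on components (the β cell's adjoint component matrix).  Literally `B9Eq310DeltaPrime.edgeLin` in components.
[cite: Balaban1985BackgroundPropagators, (3.2) p.390, (3.5) p.391 (shapes)] [folklore] -/
def edgeM (V : Fin d → Tor Nf → Matrix n n ℂ) (x : Tor Nf) (μ ν : Fin d) (j : Fin 4) : Matrix ι ((Tor Nf × Fin d) × ι) ℂ :=
  match j with
  | 0 => -tproj Nf ((adMat c e (V ν x)).map ((↑) : ℝ → ℂ)) (x + unitVec Nf ν, μ)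
  | 1 => -tproj Nf 1 (x, ν)
  | 2 => tproj Nf 1 (x, μ)
  | 3 => tproj Nf ((adMat c e (V μ x)).map ((↑) : ℝ → ℂ)) (x + unitVec Nf μ, ν)

/-- **(3.4), unit-lattice form, in components**: the row of `(D¹_U A)(p) = Σ_{b⊂∂(p)_z} A′(b)` (`= η·(D^η_U A)(p)`). [cite: Balaban1985BackgroundPropagators, (3.4) p.391 (shape)]
[folklore] -/
def curlRow (V : Fin d → Tor Nf → Matrix n n ℂ) (x : Tor Nf) (μ ν : Fin d) : Matrix ι ((Tor Nf × Fin d) × ι) ℂ :=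
  ∑ j : Fin 4, edgeM Nf c e V x μ ν j

/-! ## §3 The operator `Δ′` -/

/-- **the first (field-strength) block of (3.10) at one plaquette**: the matrix of `A ↦ tr((D¹A)(p))²·η⁻²(Re U(∂p) − 1)` on components —
`curlRowᵀ · symF(cη²·(Re U(∂p) − 1)) · curlRow`. [cite: Balaban1985BackgroundPropagators, (3.10) p.392 (shape)] [folklore] -/
def plaqBlock₁ (V : Fin d → Tor Nf → Matrix n n ℂ) (x : Tor Nf) (μ ν : Fin d) : Matrix ((Tor Nf × Fin d) × ι) ((Tor Nf × Fin d) × ι) ℂ :=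
  (curlRow Nf c e V x μ ν)ᵀ * symF c e (((cη : ℂ) ^ 2) • (reHol Nf V x μ ν - 1)) * curlRow Nf c e V x μ ν

/-- the ordered pairs `b₁ ≺ b₂` of edges of `∂(p)_z` (`j < j′` in `Fin 4`). [cite: Balaban1985BackgroundPropagators, (3.2) p.390 (shape)] [folklore] -/
def orderedPairs : Finset (Fin 4 × Fin 4) := Finset.univ.filter fun jj => jj.1 < jj.2

/-- **the second (commutator) block of (3.10) at one plaquette, polarised**: the symmetric matrix of `A ↦ tr Σ_{b₁≺b₂} i[A′(b₁), A′(b₂)]·η⁻² Im U(∂p)` —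
`Σ_{j<j′} ½(edgeM jᵀ · brkF(cη²·Im U(∂p)) · edgeM j′ + transpose)`. [cite: Balaban1985BackgroundPropagators, (3.10) p.392 (shape)] [folklore] -/
def plaqBlock₂ (V : Fin d → Tor Nf → Matrix n n ℂ) (x : Tor Nf) (μ ν : Fin d) : Matrix ((Tor Nf × Fin d) × ι) ((Tor Nf × Fin d) × ι) ℂ :=
  ∑ jj ∈ orderedPairs, (1 / 2 : ℂ) •
    ((edgeM Nf c e V x μ ν jj.1)ᵀ * brkF c e (((cη : ℂ) ^ 2) • imHol Nf V x μ ν) * edgeM Nf c e V x μ ν jj.2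
      + ((edgeM Nf c e V x μ ν jj.1)ᵀ * brkF c e (((cη : ℂ) ^ 2) • imHol Nf V x μ ν) * edgeM Nf c e V x μ ν jj.2)ᵀ)

/-- the positively oriented direction pairs `μ < ν` (one per plaquette orientation class). [folklore] -/
def dirPairs (d : ℕ) : Finset (Fin d × Fin d) := Finset.univ.filter fun q => q.1 < q.2

/-- **`Δ′` — THE CURVATURE PART OF BAŁABAN's HESSIAN (3.10) AS AN OPERATOR on component 1-forms `(Tor Nf × Fin d) × ι`**: the sum over plaquettes `p = p_{μν}(x)`,
`μ < ν`, of the two blocks (the uniform measure factor `η^d` dropped on both sides of the Riesz pairing, as for `DictionaryB0.hessB9`; `cη = η⁻¹`).  DATA: the bond field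
`V`, the component family `e` with its constant `c`.  The object only — «bounded, small» is NOT proved here. [cite: Balaban1985BackgroundPropagators, (3.10) p.392 (shape)] [folklore] -/
def deltaPrime (V : Fin d → Tor Nf → Matrix n n ℂ) : Matrix ((Tor Nf × Fin d) × ι) ((Tor Nf × Fin d) × ι) ℂ :=
  ∑ x : Tor Nf, ∑ q ∈ dirPairs d, (plaqBlock₁ Nf cη c e V x q.1 q.2 + plaqBlock₂ Nf cη c e V x q.1 q.2)

omit hNf in
/-- the first block is symmetric. [folklore] -/
theorem plaqBlock₁_transpose (V : Fin d → Tor Nf → Matrix n n ℂ) (x : Tor Nf) (μ ν : Fin d) :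
    (plaqBlock₁ Nf cη c e V x μ ν)ᵀ = plaqBlock₁ Nf cη c e V x μ ν := by
  rw [plaqBlock₁, Matrix.transpose_mul, Matrix.transpose_mul, Matrix.transpose_transpose, symF_transpose, Matrix.mul_assoc]

omit hNf in
/-- the second block is symmetric (polarised). [folklore] -/
theorem plaqBlock₂_transpose (V : Fin d → Tor Nf → Matrix n n ℂ) (x : Tor Nf) (μ ν : Fin d) :
    (plaqBlock₂ Nf cη c e V x μ ν)ᵀ = plaqBlock₂ Nf cη c e V x μ ν := by
  rw [plaqBlock₂, Matrix.transpose_sum]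
  refine Finset.sum_congr rfl fun jj _ => ?_
  rw [Matrix.transpose_smul, Matrix.transpose_add, Matrix.transpose_transpose, add_comm]

/-- **`Δ′` IS SYMMETRIC** (by construction). [folklore] -/
theorem deltaPrime_transpose (V : Fin d → Tor Nf → Matrix n n ℂ) : (deltaPrime Nf cη c e V)ᵀ = deltaPrime Nf cη c e V := by
  rw [deltaPrime, Matrix.transpose_sum]
  refine Finset.sum_congr rfl fun x _ => ?_
  rw [Matrix.transpose_sum]
  refine Finset.sum_congr rfl fun q _ => ?_
  rw [Matrix.transpose_add, plaqBlock₁_transpose, plaqBlock₂_transpose]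

omit hNf in
/-- at the flat background the first block vanishes (`Re U(∂p) − 1 = 0`). [folklore] -/
theorem plaqBlock₁_flat (x : Tor Nf) (μ ν : Fin d) : plaqBlock₁ Nf cη c e (fun (_ : Fin d) (_ : Tor Nf) => (1 : Matrix n n ℂ)) x μ ν = 0 := by
  rw [plaqBlock₁, reHol_one, sub_self, smul_zero, symF_zero, Matrix.mul_zero, Matrix.zero_mul]

omit hNf in
/-- at the flat background the second block vanishes (`Im U(∂p) = 0`). [folklore] -/
theorem plaqBlock₂_flat (x : Tor Nf) (μ ν : Fin d) : plaqBlock₂ Nf cη c e (fun (_ : Fin d) (_ : Tor Nf) => (1 : Matrix n n ℂ)) x μ ν = 0 := by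
  rw [plaqBlock₂]
  refine Finset.sum_eq_zero fun jj _ => ?_
  rw [imHol_one, smul_zero, brkF_zero, Matrix.mul_zero, Matrix.zero_mul, Matrix.transpose_zero, add_zero, smul_zero]

/-- **`Δ′ = 0` AT THE FLAT BACKGROUND** («the basic operator generalizing the operator ∂*∂ in the Abelian case»: at `U ≡ 1` the Hessian is `D*D` alone).
[cite: Balaban1985BackgroundPropagators, (3.10) p.392 (shape)] [folklore] -/
theorem deltaPrime_flat : deltaPrime Nf cη c e (fun (_ : Fin d) (_ : Tor Nf) => (1 : Matrix n n ℂ)) = 0 := by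
  rw [deltaPrime]
  refine Finset.sum_eq_zero fun x _ => Finset.sum_eq_zero fun q _ => ?_
  rw [plaqBlock₁_flat, plaqBlock₂_flat, add_zero]

end Plaquette

/-! ## §4 «For U with values in the unitary group U(N) it is a hermitian operator» (p.392): real entries, hence Hermitian -/

section Hermitian

variable {d : ℕ} (Nf : Fin d → ℕ) [hNf : ∀ μ, NeZero (Nf μ)] (cη : ℝ) (c : ℝ) (e : ι → Matrix n n ℂ)

/-! «Real entries» of a complex matrix is phrased as `Xᴴ = Xᵀ`; it is preserved by the algebra used in §3. -/

/-- products. [folklore] -/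
theorem real_mul {p q r : Type*} [Fintype q] {X : Matrix p q ℂ} {Y : Matrix q r ℂ} (hX : Xᴴ = Xᵀ) (hY : Yᴴ = Yᵀ) : (X * Y)ᴴ = (X * Y)ᵀ := by
  rw [Matrix.conjTranspose_mul, Matrix.transpose_mul, hX, hY]

/-- sums. [folklore] -/
theorem real_add {p q : Type*} {X Y : Matrix p q ℂ} (hX : Xᴴ = Xᵀ) (hY : Yᴴ = Yᵀ) : (X + Y)ᴴ = (X + Y)ᵀ := by
  rw [Matrix.conjTranspose_add, Matrix.transpose_add, hX, hY]

/-- finite sums. [folklore] -/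
theorem real_sum {p q σ : Type*} {s : Finset σ} {X : σ → Matrix p q ℂ} (hX : ∀ i ∈ s, (X i)ᴴ = (X i)ᵀ) :
    (∑ i ∈ s, X i)ᴴ = (∑ i ∈ s, X i)ᵀ := by
  rw [Matrix.conjTranspose_sum, Matrix.transpose_sum]
  exact Finset.sum_congr rfl hX

/-- negation. [folklore] -/
theorem real_neg {p q : Type*} {X : Matrix p q ℂ} (hX : Xᴴ = Xᵀ) : (-X)ᴴ = (-X)ᵀ := by
  rw [Matrix.conjTranspose_neg, Matrix.transpose_neg, hX]

/-- transpose. [folklore] -/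
theorem real_transpose {p q : Type*} {X : Matrix p q ℂ} (hX : Xᴴ = Xᵀ) : (Xᵀ)ᴴ = (Xᵀ)ᵀ := by
  ext i j
  have h := congrFun (congrFun hX j) i
  rw [Matrix.conjTranspose_apply, Matrix.transpose_apply] at h
  rw [Matrix.conjTranspose_apply, Matrix.transpose_apply, Matrix.transpose_apply, Matrix.transpose_apply, h]

/-- the scalar `½`. [folklore] -/
theorem real_half {p q : Type*} {X : Matrix p q ℂ} (hX : Xᴴ = Xᵀ) : ((1 / 2 : ℂ) • X)ᴴ = ((1 / 2 : ℂ) • X)ᵀ := by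
  rw [Matrix.conjTranspose_smul, Matrix.transpose_smul, hX]
  congr 1
  simp

omit hNf [Fintype n] [DecidableEq n] [Fintype ι] [DecidableEq ι] in
/-- transported evaluation through a real-entry colour matrix has real entries. [folklore] -/
theorem real_tproj {R : Matrix ι ι ℂ} (hR : ∀ k l, star (R k l) = R k l) (b : Tor Nf × Fin d) : (tproj Nf R b)ᴴ = (tproj Nf R b)ᵀ := by
  ext i j
  simp only [Matrix.conjTranspose_apply, Matrix.transpose_apply, tproj]
  split_ifs <;> simp [hR]

omit hNf [Fintype ι] in
/-- the edge maps have real entries. [folklore] -/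
theorem real_edgeM (V : Fin d → Tor Nf → Matrix n n ℂ) (x : Tor Nf) (μ ν : Fin d) (j : Fin 4) :
    (edgeM Nf c e V x μ ν j)ᴴ = (edgeM Nf c e V x μ ν j)ᵀ := by
  have hre : ∀ (u : Matrix n n ℂ) (k l : ι), star (((adMat c e u).map ((↑) : ℝ → ℂ)) k l) = ((adMat c e u).map ((↑) : ℝ → ℂ)) k l :=
    fun u k l => by simp [Matrix.map_apply]
  have h1 : ∀ k l : ι, star ((1 : Matrix ι ι ℂ) k l) = (1 : Matrix ι ι ℂ) k l := fun k l => by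
    rw [Matrix.one_apply]; split_ifs <;> simp
  fin_cases j
  · exact real_neg (real_tproj Nf (hre (V ν x)) _)
  · exact real_neg (real_tproj Nf h1 _)
  · exact real_tproj Nf h1 _
  · exact real_tproj Nf (hre (V μ x)) _

omit [DecidableEq n] [Fintype ι] [DecidableEq ι] in
/-- `Tr((e_k e_l + e_l e_k)·W)` is real for Hermitian `W`, `e_k`, `e_l`. [folklore] -/
theorem star_trace_anticomm_mul {W : Matrix n n ℂ} (hW : W.IsHermitian) (he : ∀ k, (e k).IsHermitian) (k l : ι) :
    star (Matrix.trace ((e k * e l + e l * e k) * W)) = Matrix.trace ((e k * e l + e l * e k) * W) := by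
  rw [← Matrix.trace_conjTranspose, Matrix.conjTranspose_mul, hW.eq, Matrix.conjTranspose_add, Matrix.conjTranspose_mul, Matrix.conjTranspose_mul,
    (he k).eq, (he l).eq, Matrix.trace_mul_comm, add_comm]

omit [DecidableEq n] [Fintype ι] [DecidableEq ι] in
/-- `Tr(i(e_k e_l − e_l e_k)·V)` is real for Hermitian `V`, `e_k`, `e_l`. [folklore] -/
theorem star_trace_comm_mul {V : Matrix n n ℂ} (hV : V.IsHermitian) (he : ∀ k, (e k).IsHermitian) (k l : ι) :
    star (Matrix.trace ((Complex.I • (e k * e l - e l * e k)) * V)) = Matrix.trace ((Complex.I • (e k * e l - e l * e k)) * V) := by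
  rw [← Matrix.trace_conjTranspose, Matrix.conjTranspose_mul, hV.eq, Matrix.conjTranspose_smul, Matrix.conjTranspose_sub, Matrix.conjTranspose_mul,
    Matrix.conjTranspose_mul, (he k).eq, (he l).eq, Matrix.trace_mul_comm, Complex.star_def, Complex.conj_I, neg_smul, ← smul_neg, neg_sub]

omit [DecidableEq n] [Fintype ι] [DecidableEq ι] in
/-- for Hermitian `W` and a Hermitian family `e`, `symF c e W` has real entries. [folklore] -/
theorem real_symF {W : Matrix n n ℂ} (hW : W.IsHermitian) (he : ∀ k, (e k).IsHermitian) : (symF c e W)ᴴ = (symF c e W)ᵀ := by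
  ext k l
  rw [Matrix.conjTranspose_apply, Matrix.transpose_apply, symF, Matrix.of_apply, star_mul', star_trace_anticomm_mul e hW he]
  congr 1
  simp

omit [DecidableEq n] [Fintype ι] [DecidableEq ι] in
/-- for Hermitian `V` and a Hermitian family `e`, `brkF c e V` has real entries. [folklore] -/
theorem real_brkF {V : Matrix n n ℂ} (hV : V.IsHermitian) (he : ∀ k, (e k).IsHermitian) : (brkF c e V)ᴴ = (brkF c e V)ᵀ := by
  ext k l
  rw [Matrix.conjTranspose_apply, Matrix.transpose_apply, brkF, Matrix.of_apply, star_mul', star_trace_comm_mul e hV he, Complex.star_def,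
    Complex.conj_ofReal]

omit hNf in
/-- the plaquette holonomy of a unitary bond field is unitary. [folklore] -/
theorem plaqHol_mem_unitaryGroup {V : Fin d → Tor Nf → Matrix n n ℂ} (hV : ∀ μ x, V μ x ∈ Matrix.unitaryGroup n ℂ) (x : Tor Nf) (μ ν : Fin d) :
    plaqHol Nf V x μ ν ∈ Matrix.unitaryGroup n ℂ := by
  have hinv : ∀ μ y, (V μ y)⁻¹ ∈ Matrix.unitaryGroup n ℂ := fun μ y => by
    rw [Matrix.inv_eq_left_inv (Matrix.mem_unitaryGroup_iff'.mp (hV μ y))]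
    exact Unitary.star_mem (hV μ y)
  unfold plaqHol
  exact Submonoid.mul_mem _ (Submonoid.mul_mem _ (Submonoid.mul_mem _ (hV μ x) (hV ν _)) (hinv μ _)) (hinv ν x)

omit hNf in
/-- «Re U(∂p)» is Hermitian for unitary `U`. [folklore] -/
theorem reHol_isHermitian {V : Fin d → Tor Nf → Matrix n n ℂ} (hV : ∀ μ x, V μ x ∈ Matrix.unitaryGroup n ℂ) (x : Tor Nf) (μ ν : Fin d) :
    (reHol Nf V x μ ν).IsHermitian := by
  have hH := plaqHol_mem_unitaryGroup Nf hV x μ ν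
  unfold reHol Matrix.IsHermitian
  rw [Matrix.inv_eq_left_inv (Matrix.mem_unitaryGroup_iff'.mp hH), Matrix.star_eq_conjTranspose, Matrix.conjTranspose_smul,
    Matrix.conjTranspose_add, Matrix.conjTranspose_conjTranspose, add_comm]
  congr 1
  simp

omit hNf in
/-- «Im U(∂p)» is Hermitian for unitary `U`. [folklore] -/
theorem imHol_isHermitian {V : Fin d → Tor Nf → Matrix n n ℂ} (hV : ∀ μ x, V μ x ∈ Matrix.unitaryGroup n ℂ) (x : Tor Nf) (μ ν : Fin d) :
    (imHol Nf V x μ ν).IsHermitian := by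
  have hH := plaqHol_mem_unitaryGroup Nf hV x μ ν
  unfold imHol Matrix.IsHermitian
  rw [Matrix.inv_eq_left_inv (Matrix.mem_unitaryGroup_iff'.mp hH), Matrix.star_eq_conjTranspose, Matrix.conjTranspose_smul,
    Matrix.conjTranspose_sub, Matrix.conjTranspose_conjTranspose]
  have hs : star (-Complex.I / 2) = Complex.I / 2 := by
    rw [Complex.star_def, map_div₀, map_neg, Complex.conj_I, neg_neg, map_ofNat]
  rw [hs, ← neg_sub (plaqHol Nf V x μ ν), smul_neg, ← neg_smul, ← neg_div]

omit [Fintype n] [DecidableEq n] [Fintype ι] [DecidableEq ι] in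
/-- a real multiple of a Hermitian matrix is Hermitian. [folklore] -/
theorem isHermitian_real_smul {X : Matrix n n ℂ} (hX : X.IsHermitian) (r : ℝ) : (((r : ℂ)) • X).IsHermitian := by
  unfold Matrix.IsHermitian at *
  rw [Matrix.conjTranspose_smul, hX, Complex.star_def, Complex.conj_ofReal]

omit hNf in
/-- the first block has real entries (unitary `V`, Hermitian family). [folklore] -/
theorem real_plaqBlock₁ {V : Fin d → Tor Nf → Matrix n n ℂ} (hV : ∀ μ x, V μ x ∈ Matrix.unitaryGroup n ℂ) (he : ∀ k, (e k).IsHermitian)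
    (x : Tor Nf) (μ ν : Fin d) : (plaqBlock₁ Nf cη c e V x μ ν)ᴴ = (plaqBlock₁ Nf cη c e V x μ ν)ᵀ := by
  have hcurl : (curlRow Nf c e V x μ ν)ᴴ = (curlRow Nf c e V x μ ν)ᵀ := real_sum fun j _ => real_edgeM Nf c e V x μ ν j
  have hW : ((((cη : ℂ)) ^ 2) • (reHol Nf V x μ ν - 1)).IsHermitian := by
    rw [← Complex.ofReal_pow]
    exact isHermitian_real_smul ((reHol_isHermitian Nf hV x μ ν).sub Matrix.isHermitian_one) _
  exact real_mul (real_mul (real_transpose hcurl) (real_symF c e hW he)) hcurl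

omit hNf in
/-- the second block has real entries (unitary `V`, Hermitian family). [folklore] -/
theorem real_plaqBlock₂ {V : Fin d → Tor Nf → Matrix n n ℂ} (hV : ∀ μ x, V μ x ∈ Matrix.unitaryGroup n ℂ) (he : ∀ k, (e k).IsHermitian)
    (x : Tor Nf) (μ ν : Fin d) : (plaqBlock₂ Nf cη c e V x μ ν)ᴴ = (plaqBlock₂ Nf cη c e V x μ ν)ᵀ := by
  have hVh : ((((cη : ℂ)) ^ 2) • imHol Nf V x μ ν).IsHermitian := by
    rw [← Complex.ofReal_pow]
    exact isHermitian_real_smul (imHol_isHermitian Nf hV x μ ν) _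
  refine real_sum fun jj _ => real_half ?_
  have h1 : ((edgeM Nf c e V x μ ν jj.1)ᵀ * brkF c e ((((cη : ℂ)) ^ 2) • imHol Nf V x μ ν) * edgeM Nf c e V x μ ν jj.2)ᴴ
      = ((edgeM Nf c e V x μ ν jj.1)ᵀ * brkF c e ((((cη : ℂ)) ^ 2) • imHol Nf V x μ ν) * edgeM Nf c e V x μ ν jj.2)ᵀ :=
    real_mul (real_mul (real_transpose (real_edgeM Nf c e V x μ ν jj.1)) (real_brkF c e hVh he)) (real_edgeM Nf c e V x μ ν jj.2)
  exact real_add h1 (real_transpose h1)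

/-- **«FOR `U` WITH VALUES IN THE UNITARY GROUP U(N) IT IS A HERMITIAN OPERATOR»** (p.392), certified for the typed object: for a unitary bond field `V` and a
Hermitian component family `e` (real `c`, `cη`), `Δ′` has real entries (`ᴴ = ᵀ`) and is symmetric (`deltaPrime_transpose`), hence Hermitian.
[cite: Balaban1985BackgroundPropagators, p.392 «For U with values in the unitary group U(N) it is a hermitian operator» (shape)] [folklore] -/
theorem deltaPrime_isHermitian {V : Fin d → Tor Nf → Matrix n n ℂ} (hV : ∀ μ x, V μ x ∈ Matrix.unitaryGroup n ℂ) (he : ∀ k, (e k).IsHermitian) :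
    (deltaPrime Nf cη c e V).IsHermitian := by
  have hreal : (deltaPrime Nf cη c e V)ᴴ = (deltaPrime Nf cη c e V)ᵀ :=
    real_sum fun x _ => real_sum fun q _ => real_add (real_plaqBlock₁ Nf cη c e hV he x q.1 q.2) (real_plaqBlock₂ Nf cη c e hV he x q.1 q.2)
  exact hreal.trans (deltaPrime_transpose Nf cη c e V)

end Hermitian

/-! ## §5 Entry formulas: the edge maps and (3.4) on component fields -/

section Entries

variable {d : ℕ} (Nf : Fin d → ℕ) [hNf : ∀ μ, NeZero (Nf μ)] (c : ℝ) (e : ι → Matrix n n ℂ)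

omit [Fintype n] [DecidableEq n] [DecidableEq ι] in
/-- transported evaluation: `(tproj R b · a)_k = (R · a(b, ·))_k`. [folklore] -/
theorem tproj_mulVec (R : Matrix ι ι ℂ) (b : Tor Nf × Fin d) (a : (Tor Nf × Fin d) × ι → ℂ) (k : ι) :
    (tproj Nf R b *ᵥ a) k = (R *ᵥ fun l => a (b, l)) k := by
  simp only [Matrix.mulVec, dotProduct, tproj, ite_mul, zero_mul]
  rw [Fintype.sum_prod_type, Finset.sum_eq_single b]
  · simp
  · intro b' _ hb'; simp [hb']
  · intro h; exact absurd (Finset.mem_univ _) h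

/-- **(3.4) IN COMPONENTS, FIRST FORM**: `(D¹_U A)(p_{μν}(x)) = Σ_{b⊂∂(p)_z} A′(b) = A_μ(x) + R(U_μ(x))A_ν(x+e_μ) − R(U_ν(x))A_μ(x+e_ν) − A_ν(x)` — i.e.
`(D¹_μA_ν)(x) − (D¹_νA_μ)(x)` with the unit-lattice covariant differences, the second form of (3.4).
[cite: Balaban1985BackgroundPropagators, (3.4) p.391 «(D^η_{U₀}A)(p) = η⁻¹(A(x, y) + R(U₀(x, y))A(y, z) + R(U₀(x, w))A(z, w) + A(w, x))» (shape)] [folklore] -/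
theorem curlRow_mulVec (V : Fin d → Tor Nf → Matrix n n ℂ) (x : Tor Nf) (μ ν : Fin d) (a : (Tor Nf × Fin d) × ι → ℂ) (k : ι) :
    (curlRow Nf c e V x μ ν *ᵥ a) k
      = (((adMat c e (V μ x)).map ((↑) : ℝ → ℂ) *ᵥ fun l => a ((x + unitVec Nf μ, ν), l)) k - a ((x, ν), k))
        - (((adMat c e (V ν x)).map ((↑) : ℝ → ℂ) *ᵥ fun l => a ((x + unitVec Nf ν, μ), l)) k - a ((x, μ), k)) := by
  rw [curlRow, Fin.sum_univ_four]
  simp only [edgeM, Matrix.add_mulVec, Matrix.neg_mulVec, Pi.add_apply, Pi.neg_apply, tproj_mulVec, Matrix.one_mulVec]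
  ring

end Entries

end Summit.QuantumFields.BalabanUV.T4Continuum.NE2.DeltaPrimeOperator

end
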